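import Mathlib
import Literature.NumberTheory.LFunctions.Zhang2022.Section17Eq171Residue
import Literature.NumberTheory.LFunctions.Zhang2022.Section8Eq81bEdge
import Literature.NumberTheory.LFunctions.Zhang2022.Section4Lemma45Edge
import HarnessLib

/-!
# Zhang (2022) §17 (17.1), contour remainder: `(1/2πi)∫_{∂ℜ} 𝔨₃(s,ψ)ω(s)ds = I₄⁺(ψ) − I₄⁻(ψ) + O(ε)`
# — the §17 twin of (8.1)b, discharged modulo Proposition 2.2

Topic `Literature/NumberTheory/LFunctions/Zhang2022` (Landau–Siegel audit tree; verdict-neutral).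
Y. Zhang, *Discrete mean estimates and the Landau–Siegel zero*, arXiv:2211.02515v1 (2022)
[Zhang2022LandauSiegel] — **an unrefereed manuscript under adjudication**; nothing here asserts or
denies its Theorems 1–2. DAG node `Z22:(17.1)` [Z22 p.95, tex L4698–L4706], second half:

> "`I₄^±(ψ) = (1/2πi)∫_{𝔍(±α)} 𝔨₃(s,ψ)ω(s)ds`. Similar to the treatment of `Φ₂`,
> `Φ₃ = Σ_{ψ∈Ψ₁}(p_ψt₀)^{β₃}(I₄⁺(ψ) − I₄⁻(ψ)) + O(ε)`"

i.e. (as for (8.1), §8 p.42 tex L2203–L2205: "By Lemma 5.9, the residue theorem and a simple bound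
for `ω(s)` … `= Ĩ₁⁺ − Ĩ₁⁻ + O(ε)`") the contour `∂ℜ` of the admissible rectangle of §8.u003 differs
from `𝔍(α) − 𝔍(−α)` by two horizontal edges (length `2α`) and four vertical slivers (length
`|𝓛₁^{±} ∓ 𝓛₁| ≤ Cα`), all at heights `|t − 2πt₀| ≥ 𝓛₁ − 1`, where `|ω(s)| ≤ e^{2−𝓛¹⁰/4}`
(`Section8aStatements.norm_omegaW_le_exp`), while
`|𝔨₃(s,ψ)| = |L(s+β₁,ψ)/L(s,ψ)|·|B(s,ψ)G(s,ψ)N(s+β₂,ψ)N(s+β₃,ψ)F(1−s,ψ̄)| ≤ C𝓛⁹·e^{O(𝓛⁹)}` by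
Lemma 5.9 on its use-range (`Skeleton.lemma59_restricted_of_prop22`, i.e. from Prop. 2.2; the
clearance `|s − ρ| ≫ α` holds on `∂ℜ` by admissibility and on `σ = ½ ± α` by Prop. 2.2 (i),
`Section8aStatements.clearance_of_prop22i`) and the TRIVIAL bounds `|B| ≤ (1+|ι₂|)(|ι₃|+|ι₄|)(P+1)²`,
`|G| ≤ D⁸`, `|N(s+β_j,ψ)| ≤ P + 1`, `|F(1−s,ψ̄)| ≤ D⁸` (finite Dirichlet polynomials with bounded
coefficients on `Re ≥ 0`); the bookkeeping `𝓛⁹(P+1)⁴D¹⁶e^{2−𝓛¹⁰/4} ≤ 16e²e^{−𝓛¹⁰/8}` holds for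
`𝓛 ≥ 80`. PROVED here:
`eq17_1b_of_prop22 : 0 ≤ c′ → Skeleton.Prop22 c′ → (∀ C c₀ > 0, ∃ c > 0, ∃ C′, ForAllLarge (∀ ψ ∈ Ψ₁,
∀ admissible (𝓛₁⁻,𝓛₁⁺), ‖(1/2πi)∫_{∂ℜ}𝔨₃ω − (I₄⁺ − I₄⁻)‖ ≤ C′e^{−c𝓛¹⁰}))` with `c = 1/8`.
The contour identity `Section8aStatements.rectIntegral_sub_segInt_eq` and the abstract piece
estimates are those of `Section8Eq81bEdge` (L2-t1; its private bookkeeping lemmas are repeated here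
verbatim, as in `Section8Eq81bFromLemma59`). No new definitions, no named facts; axioms standard.
ZHANG-L discharge lane (WP16, seat zl-w16-p7), file 2/3 toward the leaf `Typed.Section17.Eq17_1`
of `Skeleton.theorem1_of_leaves_v19`. WHAT THIS IS NOT: any claim about Proposition 2.2, Theorems
1–2 of the source, or Landau–Siegel zeros.

## References

* Y. Zhang, arXiv:2211.02515v1 (2022), §17 (17.1) p. 95 (tex L4698–L4706); §8 (8.1) p. 42
  (tex L2197–L2210); §2 (2.13), (2.15); §5 Lemma 5.9. [cite: Zhang2022LandauSiegel, §17 (17.1) p. 95]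
-/

noncomputable section

open Complex Real MeasureTheory Set intervalIntegral

namespace Literature.NumberTheory.LFunctions.Zhang2022.Typed.Section17

open Literature.NumberTheory.LFunctions.Zhang2022 Skeleton
open Literature.NumberTheory.LFunctions.Zhang2022.Section8aStatements
  (rectR onBoundaryR AdmRect rectIntegral norm_omegaW_le_exp rectIntegral_sub_segInt_eq
    clearance_of_prop22i)

/-! ### A. The parameters for large `D` -/

/-- Sizes of `α = π/log P = π/𝓛⁹` and `Cα` once `𝓛 ≥ 80`, `𝓛 ≥ 4π|C| + 1`: `0 < α ≤ 1/100`,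
`|C|α ≤ 1/4` (from `Section8Eq81bEdge`, private there; the shift sizes are not needed here).
[cite: Zhang2022LandauSiegel, §2 (2.10)] -/
theorem alpha_sizes171 {C : ℝ} {D : ℕ} (h80 : 80 ≤ ell D) (hC : 4 * π * |C| + 1 ≤ ell D) :
    0 < alpha D ∧ alpha D = π / ell D ^ 9 ∧ alpha D ≤ 1 / 100 ∧ |C| * alpha D ≤ 1 / 4 := by
  have hπ := Real.pi_pos
  have hL0 : 0 < ell D := by linarith
  have hL1 : 1 ≤ ell D := by linarith
  have hα : alpha D = π / ell D ^ 9 := by rw [alpha, bigP, Real.log_exp]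
  have hL9 : ell D ≤ ell D ^ 9 := by
    calc ell D = ell D ^ 1 := (pow_one _).symm
      _ ≤ ell D ^ 9 := pow_le_pow_right₀ hL1 (by norm_num)
  have hL9pos : 0 < ell D ^ 9 := by positivity
  have hα0 : 0 < alpha D := by rw [hα]; positivity
  have hαL : alpha D ≤ π / ell D := by
    rw [hα]; exact div_le_div_of_nonneg_left hπ.le hL0 hL9
  have hα100 : alpha D ≤ 1 / 100 := by
    have hL2 : ell D ^ 2 ≤ ell D ^ 9 := pow_le_pow_right₀ hL1 (by norm_num)
    rw [hα, div_le_iff₀ hL9pos]; nlinarith [Real.pi_lt_four]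
  have hCα : |C| * alpha D ≤ 1 / 4 := by
    have h1 : |C| * alpha D ≤ |C| * (π / ell D) := mul_le_mul_of_nonneg_left hαL (abs_nonneg C)
    have h2 : |C| * (π / ell D) ≤ 1 / 4 := by
      rw [← mul_div_assoc, div_le_iff₀ hL0]; nlinarith [abs_nonneg C]
    exact h1.trans h2
  exact ⟨hα0, hα, hα100, hCα⟩

/-- The threshold `D ≥ ⌈e^{L₀}⌉` gives `L₀ ≤ 𝓛`. [folklore] -/
private theorem threshold_le_ell {L₀ : ℝ} {D : ℕ} (hD : ⌈Real.exp L₀⌉₊ ≤ D) : L₀ ≤ ell D := by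
  have h1 : Real.exp L₀ ≤ D := (Nat.le_ceil _).trans (by exact_mod_cast hD)
  have hD0 : (0 : ℝ) < D := (Real.exp_pos _).trans_le h1
  rw [ell, Real.le_log_iff_exp_le hD0]; exact h1

/-- `2T² ≤ P` once `𝓛 ≥ 3` (`T = e^{𝓛^{1.1}}`, `P = e^{𝓛⁹}`; from `Section8aFourthMoment`, private there).
[cite: Zhang2022LandauSiegel, §2 (2.6); §6 p.30] -/
private theorem two_mul_bigT_sq_le_bigP {D : ℕ} (hL : 3 ≤ ell D) : 2 * bigT D ^ 2 ≤ bigP D := by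
  have hL1 : 1 ≤ ell D := by linarith
  have h11 : ell D ^ (1.1 : ℝ) ≤ ell D ^ 2 := by
    have := Real.rpow_le_rpow_of_exponent_le hL1 (by norm_num : (1.1 : ℝ) ≤ 2)
    rwa [Real.rpow_two] at this
  have h9 : ell D ^ 9 = ell D ^ 2 * ell D ^ 7 := by ring
  have h7 : (3 : ℝ) ^ 7 ≤ ell D ^ 7 := pow_le_pow_left₀ (by norm_num) hL 7
  have hkey : Real.log 2 + 2 * ell D ^ (1.1 : ℝ) ≤ ell D ^ 9 := by
    rw [h9]; nlinarith [Real.log_two_lt_d9]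
  rw [bigT, bigP, ← Real.exp_nat_mul]
  have : (2 : ℝ) * Real.exp ((2 : ℕ) * ell D ^ (1.1 : ℝ)) =
      Real.exp (Real.log 2 + 2 * ell D ^ (1.1 : ℝ)) := by
    rw [Real.exp_add, Real.exp_log two_pos]; push_cast; ring
  rw [this]
  exact Real.exp_le_exp.mpr hkey

/-! ### B. Trivial bounds for the Dirichlet polynomials `B, G, N` -/

section Trivial

variable {D : ℕ} (χ : DirichletCharacter ℂ D) (x : Chr D)

omit χ x in
/-- `|n^{−s}| ≤ 1` for `n ≥ 1`, `Re s ≥ 0`. [folklore] -/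
private theorem norm_natCast_cpow_neg_le_one {n : ℕ} (hn : 0 < n) {s : ℂ} (hs : 0 ≤ s.re) :
    ‖(n : ℂ) ^ (-s)‖ ≤ 1 := by
  rw [Complex.norm_natCast_cpow_of_pos hn]
  exact Real.rpow_le_one_of_one_le_of_nonpos (by exact_mod_cast hn) (by simpa using hs)

/-- The trivial bound for a Dirichlet polynomial `Σ_{n∈S} c(n)n^{−s}` over `1 ≤ n`, `|c(n)| ≤ 1`,
`Re s ≥ 0`: at most `#S`. [folklore] -/
private theorem norm_dirichletSum_le_card {S : Finset ℕ} (hS : ∀ n ∈ S, 0 < n) {c : ℕ → ℂ}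
    (hc : ∀ n ∈ S, ‖c n‖ ≤ 1) {s : ℂ} (hs : 0 ≤ s.re) :
    ‖∑ n ∈ S, c n * (n : ℂ) ^ (-s)‖ ≤ S.card := by
  calc ‖∑ n ∈ S, c n * (n : ℂ) ^ (-s)‖ ≤ ∑ n ∈ S, ‖c n * (n : ℂ) ^ (-s)‖ := norm_sum_le _ _
    _ ≤ ∑ n ∈ S, (1 : ℝ) := Finset.sum_le_sum fun n hn => by
        rw [norm_mul]
        calc ‖c n‖ * ‖(n : ℂ) ^ (-s)‖ ≤ 1 * 1 :=
              mul_le_mul (hc n hn) (norm_natCast_cpow_neg_le_one (hS n hn) hs) (norm_nonneg _)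
                zero_le_one
          _ = 1 := mul_one _
    _ = S.card := by simp

omit χ x in
/-- `#(Ico 1 ⌈y⌉) ≤ P + 1` for `0 ≤ y ≤ P`. [folklore] -/
private theorem card_Ico_ceil_le {y : ℝ} (hy : 0 ≤ y) (hyP : y ≤ bigP D) :
    ((Finset.Ico 1 ⌈y⌉₊).card : ℝ) ≤ bigP D + 1 := by
  rw [Nat.card_Ico]
  have h1 : ((⌈y⌉₊ - 1 : ℕ) : ℝ) ≤ (⌈y⌉₊ : ℝ) := by exact_mod_cast Nat.sub_le _ _
  have h2 : (⌈y⌉₊ : ℝ) < y + 1 := Nat.ceil_lt_add_one hy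
  linarith

/-- `|ψχ(n)| ≤ 1`. [cite: Zhang2022LandauSiegel, §2 (2.23)] -/
private theorem norm_pc_le_one' (n : ℕ) : ‖pc χ x n‖ ≤ 1 := by
  rw [pc, norm_mul]
  calc ‖x.ψ (n : ZMod x.p)‖ * ‖χ (n : ZMod D)‖ ≤ 1 * 1 :=
        mul_le_mul (x.ψ.norm_le_one _) (χ.norm_le_one _) (norm_nonneg _) zero_le_one
    _ = 1 := mul_one _

omit χ x in
/-- `P₁, P₂, P₃ ≤ P` (`P ≥ 1`, exponents `≤ 1`, `T ≥ 1`). [cite: Zhang2022LandauSiegel, §2 (2.21)–(2.22)] -/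
private theorem P123_le_bigP (D : ℕ) :
    Skeleton.P1 D ≤ bigP D ∧ Skeleton.P2 D ≤ bigP D ∧ Skeleton.P3 D ≤ bigP D := by
  have hP1 : 1 ≤ bigP D := by
    rw [bigP]; exact Real.one_le_exp (pow_nonneg (Real.log_natCast_nonneg D) 9)
  have hP0 : 0 ≤ bigP D := by linarith
  have hT1 : 1 ≤ bigT D ^ 10 :=
    one_le_pow₀ (by rw [bigT]; exact Real.one_le_exp (Real.rpow_nonneg (Real.log_natCast_nonneg D) _))
  have h1 : bigP D ^ (0.504 : ℝ) ≤ bigP D := by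
    have := Real.rpow_le_rpow_of_exponent_le hP1 (by norm_num : (0.504 : ℝ) ≤ 1)
    rwa [Real.rpow_one] at this
  have h2 : bigP D ^ (0.5 : ℝ) ≤ bigP D := by
    have := Real.rpow_le_rpow_of_exponent_le hP1 (by norm_num : (0.5 : ℝ) ≤ 1)
    rwa [Real.rpow_one] at this
  have h3 : bigP D ^ (0.498 : ℝ) ≤ bigP D := by
    have := Real.rpow_le_rpow_of_exponent_le hP1 (by norm_num : (0.498 : ℝ) ≤ 1)
    rwa [Real.rpow_one] at this
  refine ⟨by rw [Skeleton.P1]; exact h1, ?_, by rw [Skeleton.P3]; exact h3⟩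
  rw [Skeleton.P2]
  exact (div_le_self (Real.rpow_nonneg hP0 _) hT1).trans h2

/-- `|H₁₂(s,ψ)| ≤ P + 1` for `Re s ≥ 0` (`|ϰ₂| ≤ 1`, `|ψχ| ≤ 1`, `< P₂ ≤ P` terms).
[cite: Zhang2022LandauSiegel, §2 (2.24)] -/
private theorem norm_H12_le (hD : 2 ≤ Real.log D) {s : ℂ} (hs : 0 ≤ s.re) :
    ‖H12 χ x s‖ ≤ bigP D + 1 := by
  rw [H12]
  have h := norm_dirichletSum_le_card (S := Finset.Ico 1 ⌈Skeleton.P2 D⌉₊)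
    (c := fun n => vk2 D n * pc χ x n) (fun n hn => (Finset.mem_Ico.mp hn).1)
    (fun n _ => by
      rw [norm_mul]
      calc ‖vk2 D n‖ * ‖pc χ x n‖ ≤ 1 * 1 :=
            mul_le_mul (norm_vk2_le hD n) (norm_pc_le_one' χ x n) (norm_nonneg _) zero_le_one
        _ = 1 := mul_one _) hs
  refine h.trans (card_Ico_ceil_le ?_ (P123_le_bigP D).2.1)
  rw [Skeleton.P2]
  exact div_nonneg (Real.rpow_nonneg (Real.exp_pos _).le _) (by rw [bigT]; positivity)

/-- `|H₁₃(s,ψ)| ≤ P + 1` for `Re s ≥ 0`. [cite: Zhang2022LandauSiegel, §2 (2.25)] -/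
private theorem norm_H13_le (hD : 2 ≤ Real.log D) {s : ℂ} (hs : 0 ≤ s.re) :
    ‖H13 χ x s‖ ≤ bigP D + 1 := by
  rw [H13]
  have h := norm_dirichletSum_le_card (S := Finset.Ico 1 ⌈Skeleton.P3 D⌉₊)
    (c := fun n => vk3 D n * pc χ x n) (fun n hn => (Finset.mem_Ico.mp hn).1)
    (fun n _ => by
      rw [norm_mul]
      calc ‖vk3 D n‖ * ‖pc χ x n‖ ≤ 1 * 1 :=
            mul_le_mul (norm_vk3_le hD n) (norm_pc_le_one' χ x n) (norm_nonneg _) zero_le_one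
        _ = 1 := mul_one _) hs
  refine h.trans (card_Ico_ceil_le ?_ (P123_le_bigP D).2.2)
  rw [Skeleton.P3]; exact Real.rpow_nonneg (Real.exp_pos _).le _

/-- `|H₁₄(s,ψ)| ≤ P + 1` for `Re s ≥ 0` (a sub-sum of `H₁₁`, `< P₁ ≤ P` terms).
[cite: Zhang2022LandauSiegel, §12 (12.1)] -/
private theorem norm_H14_le (hD : 2 ≤ Real.log D) {s : ℂ} (hs : 0 ≤ s.re) :
    ‖H14 χ x s‖ ≤ bigP D + 1 := by
  rw [H14]
  have h := norm_dirichletSum_le_card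
    (S := (Finset.Ico 1 ⌈Skeleton.P1 D⌉₊).filter (fun n : ℕ => (n : ℝ) < bigP D ^ (1 / 2 : ℝ)))
    (c := fun n => vk1 D n * pc χ x n)
    (fun n hn => (Finset.mem_Ico.mp (Finset.mem_filter.mp hn).1).1)
    (fun n _ => by
      rw [norm_mul]
      calc ‖vk1 D n‖ * ‖pc χ x n‖ ≤ 1 * 1 :=
            mul_le_mul (norm_vk1_le hD n) (norm_pc_le_one' χ x n) (norm_nonneg _) zero_le_one
        _ = 1 := mul_one _) hs
  refine h.trans ?_
  have hsub : (((Finset.Ico 1 ⌈Skeleton.P1 D⌉₊).filter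
      (fun n : ℕ => (n : ℝ) < bigP D ^ (1 / 2 : ℝ))).card : ℝ) ≤ (Finset.Ico 1 ⌈Skeleton.P1 D⌉₊).card := by
    exact_mod_cast Finset.card_filter_le _ _
  refine hsub.trans (card_Ico_ceil_le ?_ (P123_le_bigP D).1)
  rw [Skeleton.P1]; exact Real.rpow_nonneg (Real.exp_pos _).le _

/-- **`|B(s,ψ)| ≤ (1+|ι₂|)(|ι₃|+|ι₄|)(P+1)²`** for `Re s ≥ 0` (trivial estimation of (12.2)).
[cite: Zhang2022LandauSiegel, §12 (12.2)] -/
theorem norm_Bpoly_le_trivial (hD : 2 ≤ Real.log D) {s : ℂ} (hs : 0 ≤ s.re) :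
    ‖Bpoly χ x s‖ ≤ (1 + ‖iota2‖) * (‖iota3‖ + ‖iota4‖) * (bigP D + 1) ^ 2 := by
  have hP : 0 ≤ bigP D + 1 := by have := (Real.exp_pos (ell D ^ 9)); rw [bigP]; linarith
  have h12 := norm_H12_le χ x hD hs
  have h13 := norm_H13_le χ x hD hs
  have h14 := norm_H14_le χ x hD hs
  have hA : ‖H14 χ x s + iota2 * H12 χ x s‖ ≤ (1 + ‖iota2‖) * (bigP D + 1) := by
    calc ‖H14 χ x s + iota2 * H12 χ x s‖ ≤ ‖H14 χ x s‖ + ‖iota2‖ * ‖H12 χ x s‖ := by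
          rw [← norm_mul]; exact norm_add_le _ _
      _ ≤ (bigP D + 1) + ‖iota2‖ * (bigP D + 1) := by gcongr
      _ = (1 + ‖iota2‖) * (bigP D + 1) := by ring
  have hB : ‖H2 χ x s‖ ≤ (‖iota3‖ + ‖iota4‖) * (bigP D + 1) := by
    rw [H2]
    calc ‖(starRingEnd ℂ) iota3 * H13 χ x s + (starRingEnd ℂ) iota4 * H12 χ x s‖
        ≤ ‖(starRingEnd ℂ) iota3‖ * ‖H13 χ x s‖ + ‖(starRingEnd ℂ) iota4‖ * ‖H12 χ x s‖ := by
          rw [← norm_mul, ← norm_mul]; exact norm_add_le _ _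
      _ ≤ ‖iota3‖ * (bigP D + 1) + ‖iota4‖ * (bigP D + 1) := by
          rw [Complex.norm_conj, Complex.norm_conj]; gcongr
      _ = (‖iota3‖ + ‖iota4‖) * (bigP D + 1) := by ring
  rw [Bpoly, norm_mul]
  calc ‖H14 χ x s + iota2 * H12 χ x s‖ * ‖H2 χ x s‖
      ≤ ((1 + ‖iota2‖) * (bigP D + 1)) * ((‖iota3‖ + ‖iota4‖) * (bigP D + 1)) :=
        mul_le_mul hA hB (norm_nonneg _) (by positivity)
    _ = (1 + ‖iota2‖) * (‖iota3‖ + ‖iota4‖) * (bigP D + 1) ^ 2 := by ring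

/-- `|υ(n)| ≤ τ(n) ≤ n` (`υ = μ ∗ μχ`, (3.1), crude form). [cite: Zhang2022LandauSiegel, §3 (3.1)] -/
private theorem norm_ups_le_self (n : ℕ) : ‖ups χ n‖ ≤ n := by
  rw [ups, LSeries.convolution_def]
  calc ‖∑ p ∈ n.divisorsAntidiagonal, (ArithmeticFunction.moebius p.1 : ℂ) *
          ((ArithmeticFunction.moebius p.2 : ℂ) * χ (p.2 : ZMod D))‖
      ≤ ∑ p ∈ n.divisorsAntidiagonal, ‖(ArithmeticFunction.moebius p.1 : ℂ) *
          ((ArithmeticFunction.moebius p.2 : ℂ) * χ (p.2 : ZMod D))‖ := norm_sum_le _ _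
    _ ≤ ∑ p ∈ n.divisorsAntidiagonal, (1 : ℝ) := Finset.sum_le_sum fun p _ => by
        rw [norm_mul, norm_mul]
        have h1 : ‖(ArithmeticFunction.moebius p.1 : ℂ)‖ ≤ 1 := by
          rw [Complex.norm_intCast]; exact_mod_cast ArithmeticFunction.abs_moebius_le_one
        have h2 : ‖(ArithmeticFunction.moebius p.2 : ℂ)‖ ≤ 1 := by
          rw [Complex.norm_intCast]; exact_mod_cast ArithmeticFunction.abs_moebius_le_one
        calc ‖(ArithmeticFunction.moebius p.1 : ℂ)‖ * (‖(ArithmeticFunction.moebius p.2 : ℂ)‖ *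
              ‖χ (p.2 : ZMod D)‖) ≤ 1 * (1 * 1) := by
              gcongr
              exact χ.norm_le_one _
          _ = 1 := by ring
    _ = n.divisorsAntidiagonal.card := by simp
    _ = n.divisors.card := by rw [← Nat.map_div_right_divisors, Finset.card_map]
    _ ≤ n := by exact_mod_cast Nat.card_divisors_le_self n

/-- **`|G(s,ψ)| ≤ D⁸`** for `Re s ≥ 0` (`Σ_{n≤D⁴}|υ(n)| ≤ Σ_{n≤D⁴} n ≤ D⁸`).
[cite: Zhang2022LandauSiegel, §3 p. 6] -/
theorem norm_Gpoly_le_trivial {s : ℂ} (hs : 0 ≤ s.re) : ‖Gpoly χ x s‖ ≤ (D : ℝ) ^ 8 := by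
  unfold Gpoly
  have hterm : ∀ n ∈ Finset.Icc 1 (D ^ 4),
      ‖ups χ n * x.ψ (n : ZMod x.p) * (n : ℂ) ^ (-s)‖ ≤ ((D ^ 4 : ℕ) : ℝ) := by
    intro n hn
    obtain ⟨h1, h2⟩ := Finset.mem_Icc.mp hn
    calc ‖ups χ n * x.ψ (n : ZMod x.p) * (n : ℂ) ^ (-s)‖
        = ‖ups χ n‖ * ‖x.ψ (n : ZMod x.p)‖ * ‖(n : ℂ) ^ (-s)‖ := by rw [norm_mul, norm_mul]
      _ ≤ n * 1 * 1 := by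
          gcongr
          · exact norm_ups_le_self χ n
          · exact x.ψ.norm_le_one _
          · exact norm_natCast_cpow_neg_le_one h1 hs
      _ = n := by ring
      _ ≤ ((D ^ 4 : ℕ) : ℝ) := by exact_mod_cast h2
  calc ‖∑ n ∈ Finset.Icc 1 (D ^ 4), ups χ n * x.ψ (n : ZMod x.p) * (n : ℂ) ^ (-s)‖
      ≤ ∑ n ∈ Finset.Icc 1 (D ^ 4), ‖ups χ n * x.ψ (n : ZMod x.p) * (n : ℂ) ^ (-s)‖ :=
        norm_sum_le _ _
    _ ≤ ∑ n ∈ Finset.Icc 1 (D ^ 4), ((D ^ 4 : ℕ) : ℝ) := Finset.sum_le_sum hterm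
    _ = (D : ℝ) ^ 8 := by
        rw [Finset.sum_const, Nat.card_Icc, nsmul_eq_mul]
        push_cast
        ring

omit χ in
/-- `|g*(y)| ≤ 1` (`g* ∈ {0} ∪ (0,1)`). [cite: Zhang2022LandauSiegel, §6 p.30; §4 (4.1)] -/
private theorem norm_gstar_le_one' (hℓ : 0 < ell D) (y : ℝ) : ‖(gstar D y : ℂ)‖ ≤ 1 := by
  rw [Complex.norm_real, Real.norm_eq_abs, gstar]
  split_ifs
  · have h30 : 0 < ell D ^ 30 := by positivity
    rw [gW, abs_of_pos (GaussWeight.gWeight_pos h30 _)]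
    exact (GaussWeight.gWeight_lt_one h30 _).le
  · simp

omit χ in
/-- **`|N(w,ψ)| ≤ P + 1`** for `Re w ≥ 0`, `𝓛 ≥ 3` (`< 2T² ≤ P` terms of modulus `≤ 1`).
[cite: Zhang2022LandauSiegel, §6 Lemma 6.1] -/
theorem norm_Nchar_le_trivial (hL : 3 ≤ ell D) {w : ℂ} (hw : 0 ≤ w.re) :
    ‖Nchar D (psiFn x) w‖ ≤ bigP D + 1 := by
  have hℓ : 0 < ell D := by linarith
  have h : Nchar D (psiFn x) w = ∑ n ∈ Finset.Ico 1 ⌈2 * bigT D ^ 2⌉₊,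
      (psiFn x n * (gstar D (bigT D ^ 2 / n) : ℂ)) * (n : ℂ) ^ (-w) := by
    rw [Nchar]; refine Finset.sum_congr rfl fun n _ => ?_; ring
  rw [h]
  have hb := norm_dirichletSum_le_card (S := Finset.Ico 1 ⌈2 * bigT D ^ 2⌉₊)
    (c := fun n => psiFn x n * (gstar D (bigT D ^ 2 / n) : ℂ)) (fun n hn => (Finset.mem_Ico.mp hn).1)
    (fun n _ => by
      rw [norm_mul]
      calc ‖psiFn x n‖ * ‖(gstar D (bigT D ^ 2 / n) : ℂ)‖ ≤ 1 * 1 :=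
            mul_le_mul (x.ψ.norm_le_one _) (norm_gstar_le_one' hℓ _) (norm_nonneg _) zero_le_one
        _ = 1 := mul_one _) hw
  exact hb.trans (card_Ico_ceil_le (by positivity) (two_mul_bigT_sq_le_bigP hL))

end Trivial

/-! ### C. The envelope and the pointwise bound for `𝔨₃(s,ψ)ω(s)` on the contour pieces -/

/-- The size bookkeeping: for `𝓛 ≥ 80`, `P = e^{𝓛⁹}`, `D = e^{𝓛}`:
`𝓛⁹·(P+1)⁴·D¹⁶·e^{2−𝓛¹⁰/4} ≤ 16e²·e^{−𝓛¹⁰/8}`. [folklore] -/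
private theorem envelope171 {L P Dr : ℝ} (hL : 80 ≤ L) (hP : P = Real.exp (L ^ 9))
    (hDr : Dr = Real.exp L) :
    L ^ 9 * (P + 1) ^ 4 * Dr ^ 16 * Real.exp (2 - L ^ 10 / 4) ≤
      16 * Real.exp 2 * Real.exp (-(L ^ 10 / 8)) := by
  have hL0 : 0 < L := by linarith
  have hL1 : 1 ≤ L := by linarith
  have hP1 : 1 ≤ P := by rw [hP]; exact Real.one_le_exp (by positivity)
  have hP0 : 0 ≤ P := by linarith
  -- `(P+1)⁴ ≤ 16 e^{4𝓛⁹}`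
  have h1 : (P + 1) ^ 4 ≤ 16 * Real.exp (4 * L ^ 9) := by
    calc (P + 1) ^ 4 ≤ (2 * P) ^ 4 := pow_le_pow_left₀ (by linarith) (by linarith) 4
      _ = 16 * Real.exp (4 * L ^ 9) := by
          rw [mul_pow, hP, ← Real.exp_nat_mul]; norm_num
  -- `D¹⁶ = e^{16𝓛} ≤ e^{𝓛⁹}`
  have h2 : Dr ^ 16 ≤ Real.exp (L ^ 9) := by
    rw [hDr, ← Real.exp_nat_mul]
    refine Real.exp_le_exp.mpr ?_
    have h8 : (80 : ℝ) ^ 8 ≤ L ^ 8 := pow_le_pow_left₀ (by norm_num) hL 8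
    have : L ^ 9 = L ^ 8 * L := by ring
    rw [this]; push_cast; nlinarith
  -- `𝓛⁹ ≤ e^{𝓛⁹}`
  have h3 : L ^ 9 ≤ Real.exp (L ^ 9) := by linarith [Real.add_one_le_exp (L ^ 9)]
  -- exponent comparison
  have h4 : Real.exp (L ^ 9) * Real.exp (4 * L ^ 9) * Real.exp (L ^ 9) * Real.exp (2 - L ^ 10 / 4)
      ≤ Real.exp 2 * Real.exp (-(L ^ 10 / 8)) := by
    rw [← Real.exp_add, ← Real.exp_add, ← Real.exp_add, ← Real.exp_add]
    refine Real.exp_le_exp.mpr ?_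
    have : L ^ 10 = L ^ 9 * L := by ring
    have h9 : 0 < L ^ 9 := by positivity
    nlinarith
  have hE0 : 0 ≤ Real.exp (2 - L ^ 10 / 4) := (Real.exp_pos _).le
  have hDr0 : 0 ≤ Dr ^ 16 := by rw [hDr]; positivity
  calc L ^ 9 * (P + 1) ^ 4 * Dr ^ 16 * Real.exp (2 - L ^ 10 / 4)
      ≤ Real.exp (L ^ 9) * (16 * Real.exp (4 * L ^ 9)) * Real.exp (L ^ 9) *
          Real.exp (2 - L ^ 10 / 4) := by
        gcongr
    _ = 16 * (Real.exp (L ^ 9) * Real.exp (4 * L ^ 9) * Real.exp (L ^ 9) *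
          Real.exp (2 - L ^ 10 / 4)) := by ring
    _ ≤ 16 * (Real.exp 2 * Real.exp (-(L ^ 10 / 8))) :=
        mul_le_mul_of_nonneg_left h4 (by norm_num)
    _ = 16 * Real.exp 2 * Real.exp (-(L ^ 10 / 8)) := by ring

/-- **"A simple bound for `ω(s)`" made effective for (17.1)**: on the pieces of `∂ℜ` off `𝔍(±α)` —
`|σ − ½| ≤ α`, `𝓛₁ − 1 ≤ |t − 2πt₀|` — given the Lemma 5.9 bound at `s`, the integrand
`𝔨₃(s,ψ)ω(s)` is `≤ K·e^{−𝓛¹⁰/8}` with `K = (|C₅₉|+1)(1+|ι₂|)(|ι₃|+|ι₄|)·16e²` free of `D`, `ψ`, `s`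
(`|L(s+β₁)/L(s)| ≤ (|C₅₉|+1)𝓛⁹`, `|B| ≤ (1+|ι₂|)(|ι₃|+|ι₄|)(P+1)²`, `|G|, |F(1−s,ψ̄)| ≤ D⁸`,
`|N(s+β_{2,3})| ≤ P+1`, `|ω| ≤ e^{2−𝓛¹⁰/4}`). [cite: Zhang2022LandauSiegel, §17 (17.1) p.95; §8 (8.1) p.42] -/
theorem norm_kfrak3_omega_le (c' : ℝ) {D : ℕ} [NeZero D] (χ : DirichletCharacter ℂ D) (x : Chr D)
    {C₅₉ : ℝ} (h80 : 80 ≤ ell D) {s : ℂ} (hσ : |s.re - 1 / 2| ≤ alpha D)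
    (ht1 : ell1 D - 1 ≤ |s.im - 2 * π * t0 D|)
    (h59 : ‖x.ψ.LFunction (s + beta1 c' D) / x.ψ.LFunction s‖ ≤ C₅₉ * Real.log (bigP D)) :
    ‖kfrak3 c' χ x s * omegaW D s‖ ≤
      (|C₅₉| + 1) * ((1 + ‖iota2‖) * (‖iota3‖ + ‖iota4‖)) * (16 * Real.exp 2) *
        Real.exp (-(ell D ^ 10 / 8)) := by
  have hL1 : 1 ≤ ell D := by linarith
  have hL2 : 2 ≤ Real.log D := by rw [← ell]; linarith
  have hL3 : 3 ≤ ell D := by linarith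
  obtain ⟨hα0, hα, hα100, -⟩ :=
    alpha_sizes171 (C := 0) h80 (by rw [abs_zero, mul_zero, zero_add]; exact hL1)
  obtain ⟨hs1, hs2⟩ := abs_le.mp hσ
  have hre0 : 0 ≤ s.re := by linarith
  have hre1 : 0 ≤ (1 - s).re := by simp only [sub_re, one_re]; linarith
  have hre2 : 0 ≤ (s + beta2 c' D).re := by simp [beta2]; linarith
  have hre3 : 0 ≤ (s + beta3 c' D).re := by simp [beta3]; linarith
  -- the six factor bounds
  have hLq : ‖x.ψ.LFunction (s + beta1 c' D) / x.ψ.LFunction s‖ ≤ (|C₅₉| + 1) * ell D ^ 9 := by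
    have hlogP : Real.log (bigP D) = ell D ^ 9 := by rw [bigP, Real.log_exp]
    rw [hlogP] at h59
    exact h59.trans (mul_le_mul_of_nonneg_right (by linarith [le_abs_self C₅₉]) (by positivity))
  have hB := norm_Bpoly_le_trivial χ x hL2 hre0
  have hG := norm_Gpoly_le_trivial χ x hre0
  have hN2 := norm_Nchar_le_trivial x hL3 hre2
  have hN3 := norm_Nchar_le_trivial x hL3 hre3
  have hF : ‖FpolyBar χ x (1 - s)‖ ≤ (D : ℝ) ^ 8 := Section4.norm_FpolyBar_le χ x hre1
  have hω : ‖omegaW D s‖ ≤ Real.exp (2 - ell D ^ 10 / 4) :=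
    norm_omegaW_le_exp (by linarith) (hσ.trans (by linarith)) ht1
  -- the envelope (`D = e^{𝓛}`)
  have hD0 : (0 : ℝ) < D := by
    have : 0 < ell D := by linarith
    rw [ell] at this
    exact_mod_cast Nat.pos_of_ne_zero (by rintro rfl; simp at this)
  have hDr : (D : ℝ) = Real.exp (ell D) := by rw [ell, Real.exp_log hD0]
  have henv := envelope171 (Dr := (D : ℝ)) h80 (rfl : bigP D = Real.exp (ell D ^ 9)) hDr
  set cι : ℝ := (1 + ‖iota2‖) * (‖iota3‖ + ‖iota4‖) with hcι
  have hcι0 : 0 ≤ cι := by positivity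
  have hP : 0 ≤ bigP D + 1 := by have := Real.exp_pos (ell D ^ 9); rw [bigP]; linarith
  -- combine
  have hsplit : ‖kfrak3 c' χ x s * omegaW D s‖ =
      ‖x.ψ.LFunction (s + beta1 c' D) / x.ψ.LFunction s‖ * ‖Bpoly χ x s‖ * ‖Gpoly χ x s‖ *
        ‖Nchar D (psiFn x) (s + beta2 c' D)‖ * ‖Nchar D (psiFn x) (s + beta3 c' D)‖ *
        ‖FpolyBar χ x (1 - s)‖ * ‖omegaW D s‖ := by
    simp only [kfrak3, norm_mul]
  rw [hsplit]
  have hK0 : 0 ≤ (|C₅₉| + 1) * cι := by positivity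
  calc ‖x.ψ.LFunction (s + beta1 c' D) / x.ψ.LFunction s‖ * ‖Bpoly χ x s‖ * ‖Gpoly χ x s‖ *
        ‖Nchar D (psiFn x) (s + beta2 c' D)‖ * ‖Nchar D (psiFn x) (s + beta3 c' D)‖ *
        ‖FpolyBar χ x (1 - s)‖ * ‖omegaW D s‖
      ≤ ((|C₅₉| + 1) * ell D ^ 9) * (cι * (bigP D + 1) ^ 2) * (D : ℝ) ^ 8 *
          (bigP D + 1) * (bigP D + 1) * (D : ℝ) ^ 8 * Real.exp (2 - ell D ^ 10 / 4) := by
        gcongr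
    _ = (|C₅₉| + 1) * cι *
          (ell D ^ 9 * (bigP D + 1) ^ 4 * (D : ℝ) ^ 16 * Real.exp (2 - ell D ^ 10 / 4)) := by ring
    _ ≤ (|C₅₉| + 1) * cι * (16 * Real.exp 2 * Real.exp (-(ell D ^ 10 / 8))) :=
        mul_le_mul_of_nonneg_left henv hK0
    _ = (|C₅₉| + 1) * cι * (16 * Real.exp 2) * Real.exp (-(ell D ^ 10 / 8)) := by ring

/-! ### D. Continuity of `𝔨₃(s,ψ)ω(s)` along the vertical lines `σ = ½ ± α` -/

/-- Along a vertical line `σ + iy` on which `L(·,ψ)` has no zero, the integrand `𝔨₃(s,ψ)ω(s)` is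
continuous in the height `y` (`𝔨₃ω = G/L(·,ψ)` with `G` entire, `Typed.Section17.differentiable_numerator3`).
[cite: Zhang2022LandauSiegel, §17 (17.1) p.95] -/
theorem continuousOn_kfrak3_omega_vertical (c' : ℝ) {D : ℕ} [NeZero D] (χ : DirichletCharacter ℂ D)
    (x : Chr D) (σ : ℝ) {S : Set ℝ} (hL : ∀ y ∈ S, x.ψ.LFunction ((σ : ℂ) + y * I) ≠ 0) :
    ContinuousOn (fun y : ℝ => kfrak3 c' χ x ((σ : ℂ) + y * I) * omegaW D ((σ : ℂ) + y * I)) S := by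
  intro y hy
  apply ContinuousAt.continuousWithinAt
  set G : ℂ → ℂ := fun z => x.ψ.LFunction (z + beta1 c' D) * Bpoly χ x z * Gpoly χ x z *
      Nchar D (psiFn x) (z + beta2 c' D) * Nchar D (psiFn x) (z + beta3 c' D) *
      FpolyBar χ x (1 - z) * omegaW D z with hG_def
  have hFG : ∀ z, kfrak3 c' χ x z * omegaW D z = G z / x.ψ.LFunction z := by
    intro z
    simp only [hG_def, kfrak3, div_eq_mul_inv]
    ring
  have hGc : Continuous G := (differentiable_numerator3 χ x c').continuous
  have hLc : Continuous x.ψ.LFunction :=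
    (DirichletCharacter.differentiable_LFunction x.ψ_ne_one).continuous
  have hline : Continuous fun y : ℝ => (σ : ℂ) + y * I := by fun_prop
  have h := ((hGc.comp hline).continuousAt (x := y)).div ((hLc.comp hline).continuousAt (x := y))
    (hL y hy)
  have heq : (fun y : ℝ => kfrak3 c' χ x ((σ : ℂ) + y * I) * omegaW D ((σ : ℂ) + y * I)) =
      fun y : ℝ => G ((σ : ℂ) + y * I) / x.ψ.LFunction ((σ : ℂ) + y * I) := funext fun y => hFG _
  rw [heq]
  exact h

/-! ### E. The abstract piece estimates (verbatim from `Section8Eq81bEdge`, private there) -/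

/-- `‖1/(2πi)‖ ≤ 1/6` and `‖1/2π‖ ≤ 1/6`. [folklore] -/
private theorem norm_prefactors_le :
    ‖(1 / (2 * π * I) : ℂ)‖ ≤ 1 / 6 ∧ ‖(1 / (2 * π) : ℂ)‖ ≤ 1 / 6 := by
  have hπ := Real.pi_gt_three
  have h1 : ‖(1 / (2 * π) : ℂ)‖ = 1 / (2 * π) := by
    rw [show (1 / (2 * π) : ℂ) = ((1 / (2 * π) : ℝ) : ℂ) by push_cast; ring, Complex.norm_real,
      Real.norm_of_nonneg (by positivity)]
  have h2 : ‖(1 / (2 * π * I) : ℂ)‖ = 1 / (2 * π) := by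
    rw [norm_div, norm_mul, Complex.norm_I, mul_one, norm_one,
      show (2 * π : ℂ) = ((2 * π : ℝ) : ℂ) by push_cast; ring, Complex.norm_real,
      Real.norm_of_nonneg (by positivity)]
  have h3 : 1 / (2 * π) ≤ (1 : ℝ) / 6 := by
    rw [div_le_div_iff₀ (by positivity) (by norm_num)]; linarith
  exact ⟨h2 ▸ h3, h1 ▸ h3⟩

/-- A horizontal edge of `∂ℜ` at height `2πt₀ + L′`, `𝓛₁ − 1 ≤ |L′| ≤ 𝓛₁ + ¼`, contributes at most
`M·2α` once the integrand is `≤ M` on the pieces (abstract bookkeeping; `P` = the clearance).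
[cite: Zhang2022LandauSiegel, §8 (8.1) p.42] -/
private theorem norm_integral_horizontal {F : ℂ → ℂ} {P : ℂ → Prop} {M α T L' ℓ : ℝ}
    (hα : 0 ≤ α)
    (hMs : ∀ s : ℂ, |s.re - 1 / 2| ≤ α → ℓ - 1 ≤ |s.im - T| → |s.im - T| ≤ ℓ + 1 / 4 → P s →
      ‖F s‖ ≤ M)
    (hL'1 : |L'| ≤ ℓ + 1 / 4) (hL'2 : ℓ - 1 ≤ |L'|)
    (hP : ∀ s : ℂ, |s.re - 1 / 2| ≤ α → s.im = T + L' → P s) :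
    ‖∫ u in (1 / 2 - α)..(1 / 2 + α), F (u + ((T + L' : ℝ) : ℂ) * I)‖ ≤
      M * |1 / 2 + α - (1 / 2 - α)| := by
  refine intervalIntegral.norm_integral_le_of_norm_le_const fun u hu => ?_
  rw [Set.uIoc_of_le (by linarith : 1 / 2 - α ≤ 1 / 2 + α)] at hu
  have hre : ((u : ℂ) + ((T + L' : ℝ) : ℂ) * I).re = u := by simp
  have him : ((u : ℂ) + ((T + L' : ℝ) : ℂ) * I).im = T + L' := by simp
  have hσ : |((u : ℂ) + ((T + L' : ℝ) : ℂ) * I).re - 1 / 2| ≤ α := by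
    rw [hre, abs_le]; constructor <;> linarith [hu.1, hu.2]
  exact hMs _ hσ (by rw [him, add_sub_cancel_left]; exact hL'2)
    (by rw [him, add_sub_cancel_left]; exact hL'1) (hP _ hσ him)

/-- A vertical sliver on `σ` (`|σ − ½| = α`) between heights `u`, `v` on the same side of `T = 2πt₀`
with `𝓛₁ − ¼ ≤ |u − T|, |v − T| ≤ 𝓛₁ + ¼` contributes at most `M·|v − u|` (abstract bookkeeping).
[cite: Zhang2022LandauSiegel, §8 (8.1) p.42] -/
private theorem norm_integral_vertical {F : ℂ → ℂ} {P : ℂ → Prop} {M α T ℓ σ u v : ℝ}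
    (hMs : ∀ s : ℂ, |s.re - 1 / 2| ≤ α → ℓ - 1 ≤ |s.im - T| → |s.im - T| ≤ ℓ + 1 / 4 → P s →
      ‖F s‖ ≤ M)
    (hσ : |σ - 1 / 2| = α)
    (hu1 : ℓ - 1 / 4 ≤ |u - T|) (hu2 : |u - T| ≤ ℓ + 1 / 4)
    (hv1 : ℓ - 1 / 4 ≤ |v - T|) (hv2 : |v - T| ≤ ℓ + 1 / 4)
    (hside : (0 ≤ u - T ∧ 0 ≤ v - T) ∨ (u - T ≤ 0 ∧ v - T ≤ 0))
    (hP : ∀ s : ℂ, |s.re - 1 / 2| = α → |s.im - T| ≤ ℓ + 1 → P s) :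
    ‖∫ y in u..v, F ((σ : ℂ) + y * I)‖ ≤ M * |v - u| := by
  refine intervalIntegral.norm_integral_le_of_norm_le_const fun y hy => ?_
  have hre : ((σ : ℂ) + y * I).re = σ := by simp
  have him : ((σ : ℂ) + y * I).im = y := by simp
  have hy' : ℓ - 1 / 4 ≤ |y - T| ∧ |y - T| ≤ ℓ + 1 / 4 := by
    rw [Set.mem_uIoc] at hy
    rcases hside with ⟨hu0, hv0⟩ | ⟨hu0, hv0⟩
    · rw [abs_of_nonneg hu0] at hu1 hu2
      rw [abs_of_nonneg hv0] at hv1 hv2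
      rcases hy with ⟨hy1, hy2⟩ | ⟨hy1, hy2⟩
      · rw [abs_of_nonneg (by linarith)]; constructor <;> linarith
      · rw [abs_of_nonneg (by linarith)]; constructor <;> linarith
    · rw [abs_of_nonpos hu0] at hu1 hu2
      rw [abs_of_nonpos hv0] at hv1 hv2
      rcases hy with ⟨hy1, hy2⟩ | ⟨hy1, hy2⟩
      · rw [abs_of_nonpos (by linarith)]; constructor <;> linarith
      · rw [abs_of_nonpos (by linarith)]; constructor <;> linarith
  exact hMs _ (by rw [hre, hσ]) (by rw [him]; linarith [hy'.1]) (by rw [him]; exact hy'.2)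
    (hP _ (by rw [hre, hσ]) (by rw [him]; linarith [hy'.2]))

/-- The final arithmetic: six pieces of size `≤ M/4` each, weighted by `‖1/2πi‖, ‖1/2π‖ ≤ 1/6`,
total at most `M`. [folklore] -/
private theorem six_pieces_le {k m Hc Hd Pb Qb Pa Qa : ℂ} {M l₁ l₂ l₃ : ℝ} (hM : 0 ≤ M)
    (hk : ‖k‖ ≤ 1 / 6) (hm : ‖m‖ ≤ 1 / 6)
    (hHc : ‖Hc‖ ≤ M * l₁) (hHd : ‖Hd‖ ≤ M * l₁) (hPb : ‖Pb‖ ≤ M * l₂) (hQb : ‖Qb‖ ≤ M * l₃)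
    (hPa : ‖Pa‖ ≤ M * l₂) (hQa : ‖Qa‖ ≤ M * l₃)
    (hl₁ : l₁ ≤ 1 / 4) (hl₂ : l₂ ≤ 1 / 4) (hl₃ : l₃ ≤ 1 / 4) :
    ‖k * (Hc - Hd) + m * (Pb - Qb) - m * (Pa - Qa)‖ ≤ M := by
  have h1 : ‖k * (Hc - Hd)‖ ≤ 1 / 6 * (M / 4 + M / 4) := by
    rw [norm_mul]
    exact mul_le_mul hk ((norm_sub_le _ _).trans (add_le_add (by nlinarith) (by nlinarith)))
      (norm_nonneg _) (by norm_num)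
  have h2 : ‖m * (Pb - Qb)‖ ≤ 1 / 6 * (M / 4 + M / 4) := by
    rw [norm_mul]
    exact mul_le_mul hm ((norm_sub_le _ _).trans (add_le_add (by nlinarith) (by nlinarith)))
      (norm_nonneg _) (by norm_num)
  have h3 : ‖m * (Pa - Qa)‖ ≤ 1 / 6 * (M / 4 + M / 4) := by
    rw [norm_mul]
    exact mul_le_mul hm ((norm_sub_le _ _).trans (add_le_add (by nlinarith) (by nlinarith)))
      (norm_nonneg _) (by norm_num)
  calc ‖k * (Hc - Hd) + m * (Pb - Qb) - m * (Pa - Qa)‖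
      ≤ ‖k * (Hc - Hd) + m * (Pb - Qb)‖ + ‖m * (Pa - Qa)‖ := norm_sub_le _ _
    _ ≤ ‖k * (Hc - Hd)‖ + ‖m * (Pb - Qb)‖ + ‖m * (Pa - Qa)‖ :=
        add_le_add (norm_add_le _ _) le_rfl
    _ ≤ 1 / 6 * (M / 4 + M / 4) + 1 / 6 * (M / 4 + M / 4) + 1 / 6 * (M / 4 + M / 4) := by
        linarith
    _ ≤ M := by linarith

/-! ### F. The edge: Proposition 2.2 ⇒ the contour remainder of (17.1) -/

set_option maxHeartbeats 400000 in
/-- **`Z22:(17.1)`, contour remainder, DISCHARGED modulo Proposition 2.2**: for `c′ ≥ 0` with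
`Skeleton.Prop22 c′`, for every admissibility pair `(C, c₀)` with `c₀ > 0` there are `c = 1/8` and
`C′` such that, for all large `D`, every `ψ ∈ Ψ₁` and every admissible rectangle `ℜ` (§8.u003),
`‖(1/2πi)∫_{∂ℜ} 𝔨₃(s,ψ)ω(s)ds − (I₄⁺(ψ) − I₄⁻(ψ))‖ ≤ C′e^{−𝓛¹⁰/8}` — "a simple bound for `ω(s)`"
on the two horizontal edges and four vertical slivers, with Lemma 5.9 on its use-range
(`Skeleton.lemma59_restricted_of_prop22`) for `L(s+β₁,ψ)/L(s,ψ)` (clearance on `∂ℜ` by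
admissibility, on `σ = ½ ± α` by Prop. 2.2 (i)) and trivial bounds for `B, G, N, F(1−s,ψ̄)`; Prop.
2.2 (i) also gives `L(s,ψ) ≠ 0` on `σ = ½ ± α`, whence the continuity that splits the vertical
integrals. [cite: Zhang2022LandauSiegel, §17 (17.1) p.95, tex L4698–L4706; §8 (8.1) p.42, tex L2203–L2205] -/
theorem eq17_1b_of_prop22 {c' : ℝ} (hc' : 0 ≤ c') (h22 : Prop22 c') :
    ∀ C c₀ : ℝ, 0 < c₀ → ∃ c : ℝ, 0 < c ∧ ∃ C' : ℝ, ForAllLarge fun D _ χ =>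
      ∀ x ∈ PsiOne χ, ∀ Lm Lp : ℝ, AdmRect D x C c₀ Lm Lp →
        ‖rectIntegral D Lm Lp (fun s => kfrak3 c' χ x s * omegaW D s) -
            (I4 c' χ x (alpha D) - I4 c' χ x (-alpha D))‖ ≤ C' * Real.exp (-c * ell D ^ 10) := by
  intro C c₀ hc₀
  have hc₁ : 0 < min c₀ 1 := lt_min hc₀ one_pos
  obtain ⟨C₅₉, D₅₉, h59⟩ := lemma59_restricted_of_prop22 hc' h22 (min c₀ 1) hc₁
  obtain ⟨D₂₂, h22i⟩ := h22.1
  set K : ℝ := (|C₅₉| + 1) * ((1 + ‖iota2‖) * (‖iota3‖ + ‖iota4‖)) * (16 * Real.exp 2) with hK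
  set L₀ : ℝ := max 80 (4 * π * |C| + 1) with hL₀
  refine ⟨1 / 8, by norm_num, K, max D₅₉ (max D₂₂ ⌈Real.exp L₀⌉₊), ?_⟩
  intro D _ χ hD hq hp x hx Lm Lp hR
  -- thresholds
  have hD59 : D₅₉ ≤ D := (le_max_left _ _).trans hD
  have hD22 : D₂₂ ≤ D := (le_max_left _ _).trans ((le_max_right _ _).trans hD)
  have hDℓ : ⌈Real.exp L₀⌉₊ ≤ D := (le_max_right _ _).trans ((le_max_right _ _).trans hD)
  have hL : L₀ ≤ ell D := threshold_le_ell hDℓ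
  have h80 : 80 ≤ ell D := (le_max_left _ _).trans hL
  have hCL : 4 * π * |C| + 1 ≤ ell D := (le_max_right _ _).trans hL
  obtain ⟨hα0, -, hα100, hCα⟩ := alpha_sizes171 h80 hCL
  have hα4 : alpha D ≤ 1 / 4 := by linarith
  have hK0 : 0 ≤ K := by rw [hK]; positivity
  have hℓ1 : (1 : ℝ) ≤ ell1 D := by rw [ell1]; exact one_le_pow₀ (by linarith)
  -- the admissible rectangle
  obtain ⟨hLp, hLm, -, hclear⟩ := hR
  have hCα' : C * alpha D ≤ 1 / 4 :=
    le_trans (mul_le_mul_of_nonneg_right (le_abs_self C) hα0.le) hCα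
  obtain ⟨hLp1, hLp2⟩ := abs_le.mp (hLp.trans hCα')
  obtain ⟨hLm1, hLm2⟩ := abs_le.mp (hLm.trans hCα')
  set F : ℂ → ℂ := fun s => kfrak3 c' χ x s * omegaW D s with hF
  -- (1) the pointwise bound `M` on the pieces, with the clearance predicate `P`
  have hMs : ∀ s : ℂ, |s.re - 1 / 2| ≤ alpha D → ell1 D - 1 ≤ |s.im - 2 * π * t0 D| →
      |s.im - 2 * π * t0 D| ≤ ell1 D + 1 / 4 →
      (∀ ρ : ℂ, x.ψ.LFunction ρ = 0 → min c₀ 1 * alpha D ≤ ‖s - ρ‖) →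
      ‖F s‖ ≤ K * Real.exp (-(ell D ^ 10 / 8)) := by
    intro s hσ ht1 ht2 hcl
    have h59s := h59 D χ hD59 hq hp x hx s hσ ht2 hcl
    exact norm_kfrak3_omega_le c' χ x h80 hσ ht1 h59s
  -- (2) the clearance: on `∂ℜ` by admissibility, on `σ = ½ ± α` by Prop. 2.2 (i)
  have h22x : ∀ s ∈ prodZeroSetOmega χ x, s.re = 1 / 2 := h22i D χ hD22 hq hp x hx
  have hclV : ∀ s : ℂ, |s.re - 1 / 2| = alpha D → |s.im - 2 * π * t0 D| ≤ ell1 D + 1 →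
      ∀ ρ : ℂ, x.ψ.LFunction ρ = 0 → min c₀ 1 * alpha D ≤ ‖s - ρ‖ := by
    intro s hσ ht ρ hρ
    have h := clearance_of_prop22i h22x hα4 hσ ht ρ hρ
    exact le_trans (mul_le_of_le_one_left hα0.le (min_le_right _ _)) h
  have hclH : ∀ L' : ℝ, (L' = Lm ∨ L' = Lp) → ∀ s : ℂ, |s.re - 1 / 2| ≤ alpha D →
      s.im = 2 * π * t0 D + L' →
      ∀ ρ : ℂ, x.ψ.LFunction ρ = 0 → min c₀ 1 * alpha D ≤ ‖s - ρ‖ := by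
    intro L' hL' s hs1 hs2 ρ hρ
    have hon : s ∈ onBoundaryR D Lm Lp := by
      refine ⟨⟨hs1, ?_, ?_⟩, ?_⟩
      · rcases hL' with rfl | rfl <;> linarith
      · rcases hL' with rfl | rfl <;> linarith
      · intro hin
        rcases hL' with rfl | rfl
        · exact absurd hin.2.1 (by rw [hs2]; exact lt_irrefl _)
        · exact absurd hin.2.2 (by rw [hs2]; exact lt_irrefl _)
    exact le_trans (mul_le_mul_of_nonneg_right (min_le_left _ _) hα0.le) (hclear s hon ρ hρ)
  -- (3) continuity along `σ = ½ ± α` on `[T − 𝓛₁ − ¼, T + 𝓛₁ + ¼]` (no zero there, by (2))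
  have hcontV : ∀ σ : ℝ, |σ - 1 / 2| = alpha D →
      ContinuousOn (fun y : ℝ => F ((σ : ℂ) + y * I))
        (Icc (2 * π * t0 D - ell1 D - 1 / 4) (2 * π * t0 D + ell1 D + 1 / 4)) := by
    intro σ hσ
    refine continuousOn_kfrak3_omega_vertical c' χ x σ (fun y hy => ?_)
    intro h0
    have hy' : |((σ : ℂ) + y * I).im - 2 * π * t0 D| ≤ ell1 D + 1 := by
      have : ((σ : ℂ) + y * I).im = y := by simp
      rw [this, abs_le]; constructor <;> linarith [hy.1, hy.2]
    have h := hclV ((σ : ℂ) + y * I) (by simpa using hσ) hy' _ h0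
    rw [sub_self, norm_zero] at h
    linarith [mul_pos hc₁ hα0]
  have hσb : |1 / 2 + alpha D - 1 / 2| = alpha D := by rw [add_sub_cancel_left, abs_of_pos hα0]
  have hσa : |1 / 2 - alpha D - 1 / 2| = alpha D := by
    rw [sub_sub_cancel_left, abs_neg, abs_of_pos hα0]
  -- (4) the contour identity
  have hE := rectIntegral_sub_segInt_eq F Lm Lp _ _
    (hcontV _ hσb) (hcontV _ hσa) (by constructor <;> linarith) (by constructor <;> linarith)
    (by constructor <;> linarith) (by constructor <;> linarith)
  have hI4p : I4 c' χ x (alpha D) = Lemma81.segInt (t0 D) (ell1 D) ((alpha D : ℝ) : ℂ) F := rfl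
  have hI4m : I4 c' χ x (-alpha D) = Lemma81.segInt (t0 D) (ell1 D) ((-alpha D : ℝ) : ℂ) F := rfl
  rw [hI4p, hI4m, hE]
  -- (5) the six pieces
  have hT1 : ∀ u : ℝ, 2 * π * t0 D + u - 2 * π * t0 D = u := fun u => by ring
  have hT2 : 2 * π * t0 D - ell1 D - 2 * π * t0 D = -ell1 D := by ring
  have hLmA : |Lm| ≤ ell1 D + 1 / 4 ∧ ell1 D - 1 / 4 ≤ |Lm| := by
    rw [abs_of_nonpos (by linarith)]; constructor <;> linarith
  have hLpA : |Lp| ≤ ell1 D + 1 / 4 ∧ ell1 D - 1 / 4 ≤ |Lp| := by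
    rw [abs_of_nonneg (by linarith)]; constructor <;> linarith
  have hℓA : |ell1 D| = ell1 D := abs_of_nonneg (by linarith)
  have hℓA' : |(-ell1 D)| = ell1 D := by rw [abs_neg, hℓA]
  have hq1 : ell1 D - 1 / 4 ≤ ell1 D := by linarith
  have hq2 : ell1 D ≤ ell1 D + 1 / 4 := by linarith
  have hHc := norm_integral_horizontal (L' := Lm) hα0.le hMs hLmA.1 (by linarith [hLmA.2])
    (hclH Lm (Or.inl rfl))
  have hHd := norm_integral_horizontal (L' := Lp) hα0.le hMs hLpA.1 (by linarith [hLpA.2])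
    (hclH Lp (Or.inr rfl))
  have hPb := norm_integral_vertical (u := 2 * π * t0 D + Lm) (v := 2 * π * t0 D - ell1 D)
    hMs hσb (by rw [hT1]; exact hLmA.2) (by rw [hT1]; exact hLmA.1) (by rw [hT2, hℓA']; exact hq1)
    (by rw [hT2, hℓA']; exact hq2) (Or.inr ⟨by rw [hT1]; linarith, by rw [hT2]; linarith⟩) hclV
  have hQb := norm_integral_vertical (u := 2 * π * t0 D + Lp) (v := 2 * π * t0 D + ell1 D)
    hMs hσb (by rw [hT1]; exact hLpA.2) (by rw [hT1]; exact hLpA.1) (by rw [hT1, hℓA]; exact hq1)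
    (by rw [hT1, hℓA]; exact hq2) (Or.inl ⟨by rw [hT1]; linarith, by rw [hT1]; linarith⟩) hclV
  have hPa := norm_integral_vertical (u := 2 * π * t0 D + Lm) (v := 2 * π * t0 D - ell1 D)
    hMs hσa (by rw [hT1]; exact hLmA.2) (by rw [hT1]; exact hLmA.1) (by rw [hT2, hℓA']; exact hq1)
    (by rw [hT2, hℓA']; exact hq2) (Or.inr ⟨by rw [hT1]; linarith, by rw [hT2]; linarith⟩) hclV
  have hQa := norm_integral_vertical (u := 2 * π * t0 D + Lp) (v := 2 * π * t0 D + ell1 D)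
    hMs hσa (by rw [hT1]; exact hLpA.2) (by rw [hT1]; exact hLpA.1) (by rw [hT1, hℓA]; exact hq1)
    (by rw [hT1, hℓA]; exact hq2) (Or.inl ⟨by rw [hT1]; linarith, by rw [hT1]; linarith⟩) hclV
  -- lengths and prefactors
  have hlenH : |1 / 2 + alpha D - (1 / 2 - alpha D)| ≤ 1 / 4 := by
    rw [show 1 / 2 + alpha D - (1 / 2 - alpha D) = 2 * alpha D by ring, abs_of_pos (by positivity)]
    linarith
  have hlen1 : |2 * π * t0 D - ell1 D - (2 * π * t0 D + Lm)| ≤ 1 / 4 := by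
    rw [show 2 * π * t0 D - ell1 D - (2 * π * t0 D + Lm) = -(Lm + ell1 D) by ring, abs_neg]
    exact hLm.trans hCα'
  have hlen2 : |2 * π * t0 D + ell1 D - (2 * π * t0 D + Lp)| ≤ 1 / 4 := by
    rw [show 2 * π * t0 D + ell1 D - (2 * π * t0 D + Lp) = -(Lp - ell1 D) by ring, abs_neg]
    exact hLp.trans hCα'
  obtain ⟨hk, hm⟩ := norm_prefactors_le
  -- (6) assemble
  have hfin : Real.exp (-(1 / 8) * ell D ^ 10) = Real.exp (-(ell D ^ 10 / 8)) := by
    congr 1; ring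
  rw [hfin]
  exact six_pieces_le (mul_nonneg hK0 (Real.exp_pos _).le) hk hm hHc hHd hPb hQb hPa hQa hlenH
    hlen1 hlen2

end Literature.NumberTheory.LFunctions.Zhang2022.Typed.Section17
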